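import Summits.SmoothPoincare4.SmoothPoincare4.Theses.InformationMetricHadamard
import Summits.SmoothPoincare4.SmoothPoincare4.Theses.EinsteinBulk
import Literature.Topology.FourManifolds.CorkPresentationHomotopySphere
import Literature.Topology.Immersions.WrinkledEmbeddingsRoundCollarTransversalRotation
import HarnessLib

/-!
# Crux `YamabeExtremalSpheres` (item stmt-SmoothPoincare4-7998, "Y1") — skeleton of line `Sketch`
# (idea card `cork-round-refill`): Y1 ⇐ Θ₄ = 0 ∧ Matveyev–CFHS ∧ RoundCorkRefill (C⁺)

Line lead's skeleton (rebuilt from the tree copy of the card,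
`Cruxes/YamabeExtremalSpheres/Ideas/cork-round-refill.md`; the ideator's `Sketch.lean` lives in the
evidence store, which is not mounted in prover jails). Shape, as specified by the card (`LineShape`):

  `isHCobordant_sphere_of_homotopySphere_four → Matveyev1996_decomposition → RoundCorkRefill → Y1`.

* `stub_thetaFour` — `Θ₄ = 0` BY NAME (Kervaire–Milnor 1963; the tree's named fact
  `Literature.Topology.FourManifolds.isHCobordant_sphere_of_homotopySphere_four`, file `ThetaFour`;
  undischarged, has its own fact seat).
* `stub_matveyev` — the two-piece cork decomposition BY NAME (Matveyev 1996 / Curtis–Freedman–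
  Hsiang–Stong 1996; named fact `Literature.Topology.FourManifolds.Matveyev1996_decomposition`,
  file `CorkDecomposition`; undischarged, XL, own fact seat).
* `stub_roundCorkRefill` — THE APEX (transfer `C⁺` of the card): for every splitting
  `S⁴ = C ∪_φ W` of the unit sphere into a compact contractible `C` and a compact `W` and every
  twist `τ ∈ Diff(∂C)`, every closed 4-manifold `P` realised as the twisted gluing
  `C ∪_{φ∘τ} W` by piece embeddings `jC, jW`, and every `η > 0`, there are a POSITION `(iC, iW)`
  of the splitting in `S⁴` and a `C^∞` metric `g₀` on `P` that is CONFORMALLY ROUND on the WHOLE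
  `W`-piece (`jW^* g₀ = c · iW^* g_S` pointwise on `W`, seam included) and whose conformal class is
  `(1 − η)`-extremal (the conclusion of Y1 for `g₀`, verbatim). RESHAPE NOTE (lead, cycle 1): the
  card's "round off the seam / off Miao's strip `U` of measure `≤ η`" was first typed with an
  exceptional set `U ⊆ W` of small round Hausdorff measure; that version is VACUOUS — the position
  `(iC, iW)` is only asked to be a smooth realisation of `S⁴ = C ∪_φ W`, so composing any position
  with a diffeomorphism of `S⁴` squeezing `iW(W)` into a cap of measure `< η` lets `U = W` swallow
  the whole roundness clause, and the stub collapses to Y1 restated. Requiring roundness on all of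
  `W` is position-robust: it says exactly that `jW^*[g₀]` is the restriction of a conformally FLAT
  (hence, `C ∪_φ W ≅ S⁴` being simply connected, standard round — Kuiper) conformal structure on
  the untwisted gluing; all corner smoothing of the line's construction then happens inside `jC(C)`
  (prescribed boundary jet `(φτ)^*`(round jet) on `∂C` instead of Bartnik data — the same
  almost-refill problem on the fixed piece `C`).
* `YamabeExtremalSpheres_of` — the sorry-free composition concluding the crux BY NAME
  (`InformationMetricHadamard.YamabeExtremalSpheres`; `…_einsteinBulk` for the twin decl of route
  `EinsteinBulk`, same statement): a homotopy 4-sphere `M` is smoothly oriented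
  (`nonempty_smoothOrientation_of_homotopyEquiv_sphere_four`, proved in the tree), hence a
  `HomotopySphere 4`; the cork presentation `HomotopySphere.exists_corkPresentation_of_facts`
  (proved in the tree from the two named facts) realises `M = C ∪_{φ∘τ} W` with `S⁴ = C ∪_φ W`;
  the apex stub applied to this realisation gives `g₀`, and the frozen-exterior clause is dropped.

Hardest stub: `stub_roundCorkRefill` (conjecture-grade: it implies Y1, which is SPC4-shielded —
`Theorems/YamabeExtremalSpheres/Negative/OfSmoothPoincare4.lean` records `SmoothPoincare4 → Y1`).
-/

noncomputable section

-- the prescribed namespace `Summit.<P>.<Sub>.…` duplicates `SmoothPoincare4` (P = Sub)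
set_option linter.dupNamespace false

open scoped Manifold ContDiff Topology ContinuousMap
open Set Function Bundle
open Literature.Topology.FourManifolds Literature.Topology.Immersions
open Literature.Geometry.Lorentzian Literature.Geometry.Lorentzian.PseudoRiemannianMetric
open Summit.SmoothPoincare4.SmoothPoincare4.Theses

namespace Summit.SmoothPoincare4.SmoothPoincare4.Cruxes.YamabeExtremalSpheres.CorkRoundRefill

/-- **Stub — `Θ₄ = 0`**, BY NAME: every homotopy 4-sphere is h-cobordant to `S⁴` (Kervaire–Milnor
1963, table p. 504; the tree's named fact `isHCobordant_sphere_of_homotopySphere_four`, proved or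
refuted at its own fact seat). [cite: KervaireMilnorAnnals1963, table p. 504 (Θ₄ = 0)] -/
theorem stub_thetaFour : isHCobordant_sphere_of_homotopySphere_four := by
  sorry

/-- **Stub — the cork decomposition theorem in Matveyev's two-piece form**, BY NAME (Matveyev 1996,
Theorem parts 1–2; Curtis–Freedman–Hsiang–Stong 1996): h-cobordant simply connected closed smooth
4-manifolds are `W₁ ∪_{φ₁} M`, `W₂ ∪_{φ₂} M` with `Wᵢ` compact contractible and `W₁ ≅ W₂` (the
tree's named fact `Matveyev1996_decomposition`, universe `0`; own fact seat, XL).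
[cite: Matveyev1996, Theorem (parts 1–2)] -/
theorem stub_matveyev : Matveyev1996_decomposition.{0} := by
  sorry

/-- **Stub — ROUND CORK REFILL (the apex `C⁺` of card cork-round-refill).** Let `S⁴ = C ∪_φ W` be a
splitting of the unit 4-sphere into a compact contractible `C` and a compact `W` (smooth, with
boundary data `bC`, `bW`), `τ ∈ Diff(∂C)`, and let the closed smooth 4-manifold `P` (Borel
σ-algebra as in the crux) be the twisted gluing `C ∪_{φ∘τ} W`, realised by piece embeddings
`jC : C → P`, `jW : W → P`. Then for every `η > 0` there are a position `(iC, iW)` of the splitting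
in `S⁴` (piece embeddings realising `S⁴ = C ∪_φ W`) and a `C^∞` metric `g₀` on `P` which is
conformally round on the whole `W`-piece (`g₀(djW v, djW w) = c(y) · ⟪d(ι∘iW) v, d(ι∘iW) w⟫` for
every `y : W`, `ι : S⁴ ↪ ℝ⁵`; the round metric is `⟪dι ·, dι ·⟫`, `RoundSphere.roundMetric_apply`)
— equivalently: `jW^*[g₀]` extends over `C` along `φ` (not `φ∘τ`) to a conformally flat structure on
`C ∪_φ W = S⁴` — and whose conformal class is `(1 − η)`-Yamabe-extremal: `(1 − η) · 8√6π · √Vol(P, h) ≤ ∫_P R_h dV_h` for every `C^∞` metric `h`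
pointwise conformal to `g₀`. Informal content (card): refill the `τ`-twisted round-cork Bartnik data
of `∂C` by a metric on the FIXED compact contractible `C` with near-sharp piecewise Yamabe quotient,
then smooth the corner inside `C` (Miao 2002, Prop. 3.1) at Yamabe cost `→ 0`; the EXACT refill is excluded
by the positive mass theorem with corners and its rigidity (Shi–Tam 2002, McFeron–Székelyhidi
2012), so this is a sharp instability statement at a known rigid configuration. Conjecture-grade:
it implies Y1. [cite: Miao2002, Prop. 3.1] [cite: ShiTam2002] [cite: Kobayashi1987] -/
theorem stub_roundCorkRefill
    (C : Type) [TopologicalSpace C] [T2Space C] [SecondCountableTopology C]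
    [ChartedSpace (EuclideanHalfSpace 4) C] [IsManifold (𝓡∂ 4) ∞ C] [CompactSpace C]
    [ContractibleSpace C] (bC : BoundaryData (𝓡∂ 4) C (𝓡 3))
    (W : Type) [TopologicalSpace W] [T2Space W] [SecondCountableTopology W]
    [ChartedSpace (EuclideanHalfSpace 4) W] [IsManifold (𝓡∂ 4) ∞ W] [CompactSpace W]
    (bW : BoundaryData (𝓡∂ 4) W (𝓡 3))
    (φ : bC.carrier ≃ₘ⟮𝓡 3, 𝓡 3⟯ bW.carrier) (τ : bC.carrier ≃ₘ⟮𝓡 3, 𝓡 3⟯ bC.carrier)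
    (hS : IsBoundaryGluing bC bW φ (𝓡 4) (Metric.sphere (0 : EuclideanSpace ℝ (Fin 5)) 1))
    (P : Type) [TopologicalSpace P] [T2Space P] [SecondCountableTopology P]
    [ChartedSpace (EuclideanSpace ℝ (Fin 4)) P] [IsManifold (𝓡 4) ∞ P] [CompactSpace P]
    [MeasurableSpace P] [BorelSpace P]
    (jC : C → P) (jW : W → P)
    (hjC : Manifold.IsSmoothEmbedding (𝓡∂ 4) (𝓡 4) ∞ jC)
    (hjW : Manifold.IsSmoothEmbedding (𝓡∂ 4) (𝓡 4) ∞ jW)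
    (hcov : range jC ∪ range jW = univ)
    (hrel : ∀ x y, jC x = jW y ↔ ∃ z, x = bC.incl z ∧ y = bW.incl (τ.trans φ z))
    (η : ℝ) (hη : 0 < η) :
    ∃ (iC : C → Metric.sphere (0 : EuclideanSpace ℝ (Fin 5)) 1)
      (iW : W → Metric.sphere (0 : EuclideanSpace ℝ (Fin 5)) 1),
      Manifold.IsSmoothEmbedding (𝓡∂ 4) (𝓡 4) ∞ iC ∧
      Manifold.IsSmoothEmbedding (𝓡∂ 4) (𝓡 4) ∞ iW ∧
      range iC ∪ range iW = univ ∧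
      (∀ x y, iC x = iW y ↔ ∃ z, x = bC.incl z ∧ y = bW.incl (φ z)) ∧
      ∃ g₀ : Bundle.ContMDiffRiemannianMetric (𝓡 4) ∞ (EuclideanSpace ℝ (Fin 4))
        (TangentSpace (𝓡 4) : P → Type _),
        (∀ y : W, ∃ c : ℝ, 0 < c ∧ ∀ v w : TangentSpace (𝓡∂ 4) y,
            g₀.inner (jW y) (mfderiv (𝓡∂ 4) (𝓡 4) jW y v) (mfderiv (𝓡∂ 4) (𝓡 4) jW y w) =
              c * inner ℝ
                (mfderiv (𝓡∂ 4) 𝓘(ℝ, EuclideanSpace ℝ (Fin 5))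
                  (Subtype.val ∘ iW : W → EuclideanSpace ℝ (Fin 5)) y v : EuclideanSpace ℝ (Fin 5))
                (mfderiv (𝓡∂ 4) 𝓘(ℝ, EuclideanSpace ℝ (Fin 5))
                  (Subtype.val ∘ iW : W → EuclideanSpace ℝ (Fin 5)) y w : EuclideanSpace ℝ (Fin 5))) ∧
        ∀ (h' : Bundle.ContMDiffRiemannianMetric (𝓡 4) ∞ (EuclideanSpace ℝ (Fin 4))
            (TangentSpace (𝓡 4) : P → Type _)) [(ofRiemannian h').HasLeviCivita],
          (∃ ψ : P → ℝ, ∀ x : P, 0 < ψ x ∧ ∀ v w : TangentSpace (𝓡 4) x,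
              h'.inner x v w = ψ x * g₀.inner x v w) →
            (1 - η) * (8 * Real.sqrt 6 * Real.pi) *
                Real.sqrt ((riemannianMeasure h' Set.univ).toReal) ≤
              ∫ x, (ofRiemannian h').scalarCurvature x ∂(riemannianMeasure h') := by
  sorry

/-- **THE SKELETON THEOREM — Y1 BY NAME** (`InformationMetricHadamard.YamabeExtremalSpheres`) from the
two named topological facts (hypotheses, discharged below by the stubs `stub_thetaFour`,
`stub_matveyev`) and the apex stub `stub_roundCorkRefill` (inside). Sorry-free composition: orient
`M` (`nonempty_smoothOrientation_of_homotopyEquiv_sphere_four`), present it as a cork twist of the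
round sphere (`HomotopySphere.exists_corkPresentation_of_facts`), unpack the piece embeddings of
the twisted gluing, apply the apex, and drop the frozen-exterior clause. -/
theorem YamabeExtremalSpheres_of (hΘ : isHCobordant_sphere_of_homotopySphere_four)
    (hM : Matveyev1996_decomposition.{0}) : InformationMetricHadamard.YamabeExtremalSpheres := by
  intro M _ _ _ _ _ _ _ _ he η hη
  obtain ⟨o⟩ := nonempty_smoothOrientation_of_homotopyEquiv_sphere_four M he
  let S : HomotopySphere 4 :=
    { carrier := M, orientation := o, nonempty_homotopyEquiv := ⟨he⟩ }
  obtain ⟨C, _, _, _, _, _, _, _, bC, W, _, _, _, _, _, _, bW, φ, τ, hS4, hP⟩ :=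
    HomotopySphere.exists_corkPresentation_of_facts hΘ hM S
  obtain ⟨jC, jW, hjC, hjW, hcov, hrel⟩ := hP
  obtain ⟨-, -, -, -, -, -, g₀, -, hY⟩ :=
    stub_roundCorkRefill C bC W bW φ τ hS4 M jC jW hjC hjW hcov hrel η hη
  exact ⟨g₀, fun h' _ hconf ↦ hY h' hconf⟩

/-- Y1 (`InformationMetricHadamard.YamabeExtremalSpheres`) from the three registered stubs alone. -/
theorem yamabeExtremalSpheres_of_stubs : InformationMetricHadamard.YamabeExtremalSpheres :=
  YamabeExtremalSpheres_of stub_thetaFour stub_matveyev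

/-- The twin decl of route `EinsteinBulk` (same statement, shared item) from the stubs. -/
theorem yamabeExtremalSpheres_einsteinBulk_of_stubs : EinsteinBulk.YamabeExtremalSpheres :=
  yamabeExtremalSpheres_of_stubs

end Summit.SmoothPoincare4.SmoothPoincare4.Cruxes.YamabeExtremalSpheres.CorkRoundRefill

end
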